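import Summits.QuantumFields.YangMills.Theorems.PencilRigidityDiagonalMirrorRPRStubRpClosureLattice

/-!
# Crux `DiagonalMirrorRPR`, line `kms-variance-lukewarm-descent`: the coordinate swap `x₀ ↔ x₁` of the unsheared
# box torus and `Z(n₀, n₁, N) = Z(n₁, n₀, N)`

The purity `Z(N,2N,N)/Z(N,N,N)²` of the line is defined with the DOUBLED period in the `e₁` slot, while the slice
transfer calculus (`…SliceTransfer`) slices along `e₀`.  The hypercubic swap `x₀ ↔ x₁` (with the edge directions
`0 ↔ 1` swapped) is a symmetry of Wilson's action on the unsheared box torus (the `(0,1)` plaquette is mapped to the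
`(1,0)` plaquette, its inverse, of equal `Re tr` for unitary `ρ`), and relabelling the edges preserves product Haar
measure, so `tZ ρ n₀ n₁ N β false = tZ ρ n₁ n₀ N β false`; in particular `Z(N,2N,N) = Z(2N,N,N) = Tr 𝕋^{2N}`;
and expectations transform accordingly (`texp_swap`, appended).
-/

set_option autoImplicit false

noncomputable section

open MeasureTheory
open Literature.MathematicalPhysics.QuantumLattice Literature.MathematicalPhysics.QuantumFieldTheory

namespace Summit.QuantumFields.YangMills.Cruxes.DiagonalMirrorRPR.KmsVarianceLukewarmDescent

open ParityBridgeColdTraces ParityBridgeColdTraces.RpClosure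

section Swap

variable {n₀ n₁ N : ℕ}

/-- The site swap `(x₀, x₁, y, z) ↦ (x₁, x₀, y, z)` between the box tori `(n₀, n₁, N)` and `(n₁, n₀, N)`. -/
def bswapSite (x : TSite n₀ n₁ N) : TSite n₁ n₀ N := (x.2.1, x.1, x.2.2)

/-- The direction swap `0 ↔ 1`. -/
def bswapDir (i : Fin 4) : Fin 4 := Equiv.swap (0 : Fin 4) 1 i

/-- `0 ↦ 1`. -/
@[simp] theorem bswapDir_zero : bswapDir 0 = 1 := by simp [bswapDir]
/-- `1 ↦ 0`. -/
@[simp] theorem bswapDir_one : bswapDir 1 = 0 := by simp [bswapDir]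
/-- `2 ↦ 2`. -/
@[simp] theorem bswapDir_two : bswapDir 2 = 2 := by decide
/-- `3 ↦ 3`. -/
@[simp] theorem bswapDir_three : bswapDir 3 = 3 := by decide

/-- The site swap is additive. -/
theorem bswapSite_add (x y : TSite n₀ n₁ N) : bswapSite (x + y) = bswapSite x + bswapSite y := rfl

/-- The site swap exchanges the steps `e₀ ↔ e₁` and fixes `e₂, e₃`. -/
theorem bswapSite_tstep (i : Fin 4) :
    bswapSite (tstep false i : TSite n₀ n₁ N) = (tstep false (bswapDir i) : TSite n₁ n₀ N) := by
  fin_cases i <;> simp [bswapSite, tstep, bswapDir, Equiv.swap_apply_of_ne_of_ne]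

/-- The site swap is a bijection (it is an involution up to the exchange of the two period parameters). -/
def bswapSiteEquiv : TSite n₀ n₁ N ≃ TSite n₁ n₀ N where
  toFun := bswapSite
  invFun := bswapSite
  left_inv _ := rfl
  right_inv _ := rfl

/-- The induced relabelling of positively oriented edges. -/
def bswapEdge : TEdge n₀ n₁ N ≃ TEdge n₁ n₀ N where
  toFun e := (bswapSite e.1, bswapDir e.2)
  invFun e := (bswapSite e.1, bswapDir e.2)
  left_inv e := by obtain ⟨x, i⟩ := e; simp [bswapDir, bswapSite]
  right_inv e := by obtain ⟨x, i⟩ := e; simp [bswapDir, bswapSite]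

variable {G : Type}

/-- Pull-back of a configuration of the swapped torus. -/
def bswapConfig (U : TConfig n₁ n₀ N G) : TConfig n₀ n₁ N G := fun e => U (bswapEdge e)

variable [Group G]

/-- Plaquettes of the pulled-back configuration are the swapped plaquettes. -/
theorem tplaq_bswapConfig (U : TConfig n₁ n₀ N G) (x : TSite n₀ n₁ N) (i j : Fin 4) :
    tplaq false (bswapConfig U) x i j = tplaq false U (bswapSite x) (bswapDir i) (bswapDir j) := by
  simp only [tplaq, bswapConfig, bswapEdge, Equiv.coe_fn_mk, bswapSite_add, bswapSite_tstep]

/-- Reversing the order of the two directions inverts the plaquette holonomy. -/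
theorem tplaq_symm (shear : Bool) (U : TConfig n₀ n₁ N G) (x : TSite n₀ n₁ N) (i j : Fin 4) :
    tplaq shear U x j i = (tplaq shear U x i j)⁻¹ := by
  simp only [tplaq, mul_inv_rev, inv_inv, mul_assoc]

variable {Nc : ℕ} (ρ : G →* Matrix (Fin Nc) (Fin Nc) ℂ)

/-- Expansion of the ordered-pair sum over `Fin 4`. -/
theorem sum_lt_pairs_fin_four (f : Fin 4 → Fin 4 → ℝ) :
    (∑ i : Fin 4, ∑ j : Fin 4, if i < j then f i j else 0) =
      f 0 1 + f 0 2 + f 0 3 + f 1 2 + f 1 3 + f 2 3 := by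
  simp only [Fin.sum_univ_four, Fin.lt_def]
  simp
  ring

/-- **Wilson's action is invariant under the coordinate swap** (unitary `ρ`). -/
theorem taction_bswapConfig [NeZero n₀] [NeZero n₁] [NeZero N]
    (hρu : ∀ g, ρ g ∈ Matrix.unitaryGroup (Fin Nc) ℂ) (U : TConfig n₁ n₀ N G) :
    taction ρ false (bswapConfig U) = taction ρ false U := by
  unfold taction
  rw [← (bswapSiteEquiv (n₀ := n₀) (n₁ := n₁) (N := N)).sum_comp]
  refine Finset.sum_congr rfl fun x _ => ?_
  simp only [tplaq_bswapConfig, sum_lt_pairs_fin_four, bswapDir_zero, bswapDir_one, bswapDir_two, bswapDir_three]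
  have h10 : (ρ (tplaq false U (bswapSite x) 1 0)).trace.re = (ρ (tplaq false U (bswapSite x) 0 1)).trace.re := by
    rw [tplaq_symm, re_trace_map_inv ρ hρu]
  rw [h10]
  simp only [show ∀ y, bswapSiteEquiv (n₀ := n₀) (n₁ := n₁) (N := N) y = bswapSite y from fun _ => rfl]
  ring

variable [MeasurableSpace G]

omit [Group G] in
/-- The edge relabelling as a measurable equivalence of configuration spaces. -/
def bswapConfigEquiv : TConfig n₁ n₀ N G ≃ᵐ TConfig n₀ n₁ N G :=
  MeasurableEquiv.piCongrLeft (fun _ : TEdge n₀ n₁ N => G) (bswapEdge (n₀ := n₀) (n₁ := n₁) (N := N)).symm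

omit [Group G] in
/-- The measurable equivalence is the pull-back. -/
theorem bswapConfigEquiv_apply (U : TConfig n₁ n₀ N G) : bswapConfigEquiv U = bswapConfig U := by
  funext e
  simp only [bswapConfigEquiv, MeasurableEquiv.coe_piCongrLeft, Equiv.piCongrLeft_apply_eq_cast, cast_eq,
    Equiv.symm_symm, bswapConfig]

variable [TopologicalSpace G] [IsTopologicalGroup G] [CompactSpace G] [BorelSpace G]

/-- Relabelling the edges preserves product Haar measure. -/
theorem measurePreserving_bswapConfigEquiv [NeZero n₀] [NeZero n₁] [NeZero N] :
    MeasurePreserving (bswapConfigEquiv : TConfig n₁ n₀ N G ≃ᵐ TConfig n₀ n₁ N G)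
      (thaar n₁ n₀ N) (thaar n₀ n₁ N) := by
  unfold thaar bswapConfigEquiv
  exact measurePreserving_piCongrLeft (μ := fun _ : TEdge n₀ n₁ N => haarProbability G)
    (bswapEdge (n₀ := n₀) (n₁ := n₁) (N := N)).symm

/-- **`Z(n₀, n₁, N) = Z(n₁, n₀, N)`** for the unsheared box torus and unitary `ρ`. -/
theorem tZ_swap [NeZero n₀] [NeZero n₁] [NeZero N] (hρu : ∀ g, ρ g ∈ Matrix.unitaryGroup (Fin Nc) ℂ) (β : ℝ) :
    tZ ρ n₀ n₁ N β false (G := G) = tZ ρ n₁ n₀ N β false := by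
  unfold tZ
  rw [← (measurePreserving_bswapConfigEquiv (n₀ := n₀) (n₁ := n₁) (N := N) (G := G)).integral_comp']
  refine integral_congr_ae (Filter.Eventually.of_forall fun U => ?_)
  simp only [bswapConfigEquiv_apply, tweight, taction_bswapConfig ρ hρu]

/-- **Registered sub-goal `stub_tZ_swap` of `stub_secondMomentLever`** (purity's `Z(N,2N,N)` is `Z(2N,N,N) = Tr 𝕋^{2N}`
for the `e₀`-slice transfer operator): the box-torus partition function is symmetric in its two free periods. -/
theorem stub_tZ_swap :
    ∀ {n₀ n₁ N : ℕ} [NeZero n₀] [NeZero n₁] [NeZero N] {G : Type} [Group G] [TopologicalSpace G]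
      [IsTopologicalGroup G] [CompactSpace G] [MeasurableSpace G] [BorelSpace G] {Nc : ℕ}
      (ρ : G →* Matrix (Fin Nc) (Fin Nc) ℂ), (∀ g, ρ g ∈ Matrix.unitaryGroup (Fin Nc) ℂ) → ∀ β : ℝ,
      tZ ρ n₀ n₁ N β false (G := G) = tZ ρ n₁ n₀ N β false :=
  fun ρ hρu β => tZ_swap ρ hρu β

/-- **Expectations are invariant under the coordinate swap**: `⟨F⟩_{(n₀,n₁,N)} = ⟨F ∘ swap⟩_{(n₁,n₀,N)}` for the unsheared
box tori and unitary `ρ` (measure preservation of the edge relabelling, invariance of the action, `tZ_swap`). -/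
theorem texp_swap [NeZero n₀] [NeZero n₁] [NeZero N] (hρu : ∀ g, ρ g ∈ Matrix.unitaryGroup (Fin Nc) ℂ) (β : ℝ)
    (F : TConfig n₀ n₁ N G → ℂ) :
    texp ρ β false F = texp ρ β false (fun V : TConfig n₁ n₀ N G => F (bswapConfig V)) := by
  unfold texp
  rw [tZ_swap ρ hρu β,
    ← (measurePreserving_bswapConfigEquiv (n₀ := n₀) (n₁ := n₁) (N := N) (G := G)).integral_comp']
  congr 1
  refine integral_congr_ae (Filter.Eventually.of_forall fun U => ?_)
  simp only [bswapConfigEquiv_apply, tweight, taction_bswapConfig ρ hρu]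

end Swap

end Summit.QuantumFields.YangMills.Cruxes.DiagonalMirrorRPR.KmsVarianceLukewarmDescent

end
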